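/-
Copyright (c) 2026 the pub-hodgecm-mathlib formalisation cell (harness21).  Prover seat hodgecm-mathlib-K2E4-p23 (g2), Track B ∕ K2-LIT, h413 =
`stmt-HodgeConjecture-24833`, ENGINE E1, 5Res campaign «BL-2(χ,τ) ∘ MS-2(χ,τ) ∘ ARCH-UNITARITY ∘ R8₂», deal (80) «(d) ARCH-UNITARITY FILE 2 + FILE 3, Hecke∕unitarity road of
record» of the dealer K2E1-plan (g6) 2026-09-04T10:34:42Z: FILE 3 (F3), the HILBERT-SPACE ASSEMBLY, hypothesis-first on the matrix-coefficient letter `hmc`.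
-/
import Literature.NumberTheory.Automorphic.AutomorphicSpectrum     -- ★ `AdelicGroupData.rightRegular`, `isUnitary_rightRegular`, `ContRepresentation.IsUnitary.inner_map_map`
import HarnessLib

/-!
# K2·E1 — `K2E1ArchUnitarityOfMatrixCoefficient`: A DIAGONAL MATRIX COEFFICIENT OF A UNITARY REPRESENTATION ALONG AN INVERSION-CLOSED FAMILY IS HERMITIAN — HENCE REAL
# WHENEVER THE COEFFICIENT FUNCTION IS INVERSION-SYMMETRIC (FILE 3 of ARCH-UNITARITY: the global half, letter `hmc`)

Track B ∕ K2-LIT, crux h413 = `stmt-HodgeConjecture-24833`, route of record `HCCMUnconditional`; cell `hodgecm-mathlib`, squad K2, ENGINE E1 (socket module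
`K2_E1_TraceFormulaBetaSigs_GlobalIndex` ED. 12, live socket 5Res :247).  Prover seat `hodgecm-mathlib-K2E4-p23` (g2); deal (80) of the dealer K2E1-plan (g6).  THEOREMS ONLY
(no `def`, no `instance`, no notation, no named-fact hypothesis, no `sorry`); lane `--supports stmt-HodgeConjecture-24833 --as helper` (count-neutral).  CLOSES NO SOCKET.

THE ARGUMENT (ARCH-UNITARITY, global half; [Folland1995, §3.1, §3.3 (functions of positive type); Bump1997, §2.6 Thm. 2.6.3; MoeglinWaldspurger1995, IV.3]).  Let `π` be a UNITARY
representation on a Hilbert space `H` (for E1: the right regular representation `R` of `G(𝔸)` on `L²(G(F)∖G(𝔸), μ)`, ★ `isUnitary_rightRegular`), `ψ ∈ H`, `ψ ≠ 0`, and `a ↦ t(a)`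
(`a > 0`) a family of group elements closed under inversion, `t(a⁻¹) = t(a)⁻¹` (E1: the split archimedean torus `t_v(a) = diag(a, a⁻¹)` of `U(1,1)` at ONE real place `v`).  Unitarity
gives `π(g)* = π(g⁻¹)`, so the diagonal matrix coefficient `c(a) := ⟪π(t(a))ψ, ψ⟫` is HERMITIAN: `c(a⁻¹) = conj c(a)`.  If moreover `c(a) = Φ(a)·‖ψ‖²` for a scalar function `Φ` with the
WEYL SYMMETRY `Φ(a⁻¹) = Φ(a)` (★ `K2E1ArchTorusCoefficientU11Defs.archTorusCoeff_inv` for the `U(1,1)` torus coefficient `Φ_{s,m}`), then `Φ(a) = conj Φ(a)`: **`Φ` IS REAL ON `a > 0`**.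
FILE 2 (F2b) turns «`Φ_{s,m}` real» into «`Im(s² − s) = 0`», i.e. `t_v = 0 ∨ z₀ = ½` for the arch datum `s = z₀ + it_v` of a residual vector — the pole COUNT per `K`-type.
THE LETTER `hmc` (hypothesis here; payer = the (χ,τ)-campaign): «`⟪R(t_v(a))ψ, ψ⟫ = Φ_{z₀+it_v, p−q}(a)·‖ψ‖²` for the residual vector `ψ = Res_{z₀} E(χ, φ_κ ⊗ φ^v)` of
`K_v`-type `κ = (p,q)`» (`R(y)E(φ) = E(π(y)φ)`, `P_κ π_{z₀}(t_v(a))φ_κ = Φ·φ_κ` by multiplicity one of `κ` in `I(χ_v, z₀)`, orthogonality of `K_v`-types).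
WHAT IS HERE.  §1 (pure inner-product-space algebra) `im_eq_zero_of_adjoint_family` and `conj_eq_self_of_adjoint_family`: for ANY maps `U a : H → H` with the adjoint relation
`⟪U a x, y⟫ = ⟪x, U a⁻¹ y⟫` (`a > 0`), `ψ ≠ 0`, `Φ(a⁻¹) = Φ(a)` and `hmc`, every `Φ a` (`a > 0`) is real.  §2 `inner_apply_eq_inner_apply_inv` (a unitary `ContRepresentation` satisfies the
adjoint relation along any inversion-closed family) and **`im_eq_zero_of_isUnitary_matrixCoeff`** (§1 for unitary `π` and `t : ℝ → G` with `t a⁻¹ = (t a)⁻¹`).  §3 the E1 reading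
**`im_eq_zero_of_rightRegular_matrixCoeff`**: `π = 𝒢.rightRegular μ` on `𝒢.L2 μ` for ANY ★ adelic group datum `𝒢` and any measure `μ` with `SMulInvariantMeasure` (every rank, every group).
NOT here: the construction of the single-place torus family `t_v` in `(quasiSplit L⁺ L c 2).Adelic` and the discharge of `hmc` (payer's side); the expansion of `Φ_{s,m}` (F2b).
HONEST LABEL: HC_CM is proved only modulo the 7 printed citations (2 remaining named inputs: hLiu418 = `stmt-HodgeConjecture-24832`, h413 = `stmt-HodgeConjecture-24833`) until rung 0
closes; this file asserts no named fact and closes no socket; count-neutral.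

## References
* [Folland1995] G. B. Folland, *A Course in Abstract Harmonic Analysis* (1995), §3.1 (`π(x⁻¹) = π(x)*`), §3.3 (functions of positive type are Hermitian).
* [Bump1997] D. Bump, *Automorphic Forms and Representations* (1997), §2.6 Thm. 2.6.3.
* [MoeglinWaldspurger1995] C. Mœglin, J.-L. Waldspurger, *Spectral Decomposition and Eisenstein Series* (1995), IV.3, V.3.13.
-/

set_option autoImplicit false
-- the mandated namespace repeats the single-problem summit's segment (`HodgeConjecture.HodgeConjecture`)
set_option linter.dupNamespace false

noncomputable section

open MeasureTheory Complex
open scoped InnerProductSpace ComplexConjugate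
open Literature.NumberTheory.Automorphic

namespace Summit.HodgeConjecture.HodgeConjecture.Cruxes.H413.K2E1ArchUnitarityOfMatrixCoefficient

/-! ## §1 Pure inner-product-space algebra -/

section Abstract

variable {H : Type*} [NormedAddCommGroup H] [InnerProductSpace ℂ H]

/-- **HERMITIAN SYMMETRY OF A DIAGONAL MATRIX COEFFICIENT.**  If the maps `U a` (`a > 0`) satisfy the adjoint relation `⟪U a x, y⟫ = ⟪x, U a⁻¹ y⟫`, then
`⟪U a⁻¹ ψ, ψ⟫ = conj ⟪U a ψ, ψ⟫`. [cite: Folland1995, §3.1 and §3.3] -/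
theorem inner_inv_eq_conj (U : ℝ → H → H) (hU : ∀ a : ℝ, 0 < a → ∀ x y : H, ⟪U a x, y⟫_ℂ = ⟪x, U a⁻¹ y⟫_ℂ) (ψ : H) {a : ℝ} (ha : 0 < a) :
    ⟪U a⁻¹ ψ, ψ⟫_ℂ = conj ⟪U a ψ, ψ⟫_ℂ := by
  rw [hU a ha ψ ψ, inner_conj_symm]

/-- **A DIAGONAL MATRIX COEFFICIENT WITH AN INVERSION-SYMMETRIC SCALAR IS REAL (conjugation form).**  Under the adjoint relation for `U`, if `⟪U a ψ, ψ⟫ = Φ(a)·‖ψ‖²` (`a > 0`) for a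
non-zero `ψ` and a scalar function with `Φ(a⁻¹) = Φ(a)`, then `conj (Φ a) = Φ a` for every `a > 0`. [cite: Folland1995, §3.3] [cite: Bump1997, §2.6 Thm. 2.6.3] -/
theorem conj_eq_self_of_adjoint_family (U : ℝ → H → H) (hU : ∀ a : ℝ, 0 < a → ∀ x y : H, ⟪U a x, y⟫_ℂ = ⟪x, U a⁻¹ y⟫_ℂ)
    {ψ : H} (hψ : ψ ≠ 0) (Φ : ℝ → ℂ) (hΦ : ∀ a : ℝ, 0 < a → Φ a⁻¹ = Φ a)
    (hmc : ∀ a : ℝ, 0 < a → ⟪U a ψ, ψ⟫_ℂ = Φ a * ((‖ψ‖ ^ 2 : ℝ) : ℂ)) {a : ℝ} (ha : 0 < a) :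
    conj (Φ a) = Φ a := by
  have hn : ((‖ψ‖ ^ 2 : ℝ) : ℂ) ≠ 0 := by
    exact_mod_cast (pow_pos (norm_pos_iff.2 hψ) 2).ne'
  have h := inner_inv_eq_conj U hU ψ ha
  rw [hmc a ha, hmc a⁻¹ (inv_pos.2 ha), hΦ a ha, map_mul, Complex.conj_ofReal] at h
  exact (mul_right_cancel₀ hn h).symm

/-- **… (imaginary-part form)**: `Im Φ(a) = 0` for every `a > 0`. [cite: Folland1995, §3.3] [cite: Bump1997, §2.6 Thm. 2.6.3] -/
theorem im_eq_zero_of_adjoint_family (U : ℝ → H → H) (hU : ∀ a : ℝ, 0 < a → ∀ x y : H, ⟪U a x, y⟫_ℂ = ⟪x, U a⁻¹ y⟫_ℂ)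
    {ψ : H} (hψ : ψ ≠ 0) (Φ : ℝ → ℂ) (hΦ : ∀ a : ℝ, 0 < a → Φ a⁻¹ = Φ a)
    (hmc : ∀ a : ℝ, 0 < a → ⟪U a ψ, ψ⟫_ℂ = Φ a * ((‖ψ‖ ^ 2 : ℝ) : ℂ)) {a : ℝ} (ha : 0 < a) :
    (Φ a).im = 0 :=
  Complex.conj_eq_iff_im.1 (conj_eq_self_of_adjoint_family U hU hψ Φ hΦ hmc ha)

end Abstract

/-! ## §2 Unitary representations: the adjoint relation along an inversion-closed family -/

section Unitary

variable {G : Type*} [Group G] {H : Type*} [NormedAddCommGroup H] [InnerProductSpace ℂ H] [CompleteSpace H]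

/-- For a UNITARY representation, `⟪π g x, y⟫ = ⟪x, π g⁻¹ y⟫` (`π(g)* = π(g⁻¹)`): `⟪π g x, y⟫ = ⟪π g x, π g (π g⁻¹ y)⟫ = ⟪x, π g⁻¹ y⟫`. [cite: Folland1995, §3.1] -/
theorem inner_apply_eq_inner_apply_inv {π : ContRepresentation ℂ G H} (hπ : π.IsUnitary) (g : G) (x y : H) :
    ⟪π g x, y⟫_ℂ = ⟪x, π g⁻¹ y⟫_ℂ := by
  have hy : π g (π g⁻¹ y) = y := by
    change (π g * π g⁻¹) y = y
    rw [← map_mul, mul_inv_cancel, map_one]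
    rfl
  conv_lhs => rw [← hy]
  exact hπ.inner_map_map g x (π g⁻¹ y)

/-- **ARCH-UNITARITY, GLOBAL HALF (abstract unitary representation).**  Let `π` be a unitary representation of `G` on a Hilbert space, `t : ℝ → G` a family with `t a⁻¹ = (t a)⁻¹` for
`a > 0` (a split torus through one archimedean place), `ψ ≠ 0`, and suppose the diagonal matrix coefficient along `t` is a scalar function times `‖ψ‖²`,
`⟪π (t a) ψ, ψ⟫ = Φ(a)·‖ψ‖²` (the letter `hmc`), with `Φ(a⁻¹) = Φ(a)` (Weyl symmetry).  Then `Φ(a)` is REAL for every `a > 0`.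
[cite: Folland1995, §3.1 and §3.3] [cite: Bump1997, §2.6 Thm. 2.6.3] [cite: MoeglinWaldspurger1995, IV.3] -/
theorem im_eq_zero_of_isUnitary_matrixCoeff {π : ContRepresentation ℂ G H} (hπ : π.IsUnitary) (t : ℝ → G) (ht : ∀ a : ℝ, 0 < a → t a⁻¹ = (t a)⁻¹)
    {ψ : H} (hψ : ψ ≠ 0) (Φ : ℝ → ℂ) (hΦ : ∀ a : ℝ, 0 < a → Φ a⁻¹ = Φ a)
    (hmc : ∀ a : ℝ, 0 < a → ⟪π (t a) ψ, ψ⟫_ℂ = Φ a * ((‖ψ‖ ^ 2 : ℝ) : ℂ)) {a : ℝ} (ha : 0 < a) :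
    (Φ a).im = 0 := by
  refine im_eq_zero_of_adjoint_family (fun b x => π (t b) x) (fun b hb x y => ?_) hψ Φ hΦ hmc ha
  show ⟪π (t b) x, y⟫_ℂ = ⟪x, π (t b⁻¹) y⟫_ℂ
  rw [ht b hb]
  exact inner_apply_eq_inner_apply_inv hπ (t b) x y

/-- Conjugation form of `im_eq_zero_of_isUnitary_matrixCoeff`: `conj (Φ a) = Φ a`. [cite: Folland1995, §3.3] -/
theorem conj_eq_self_of_isUnitary_matrixCoeff {π : ContRepresentation ℂ G H} (hπ : π.IsUnitary) (t : ℝ → G) (ht : ∀ a : ℝ, 0 < a → t a⁻¹ = (t a)⁻¹)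
    {ψ : H} (hψ : ψ ≠ 0) (Φ : ℝ → ℂ) (hΦ : ∀ a : ℝ, 0 < a → Φ a⁻¹ = Φ a)
    (hmc : ∀ a : ℝ, 0 < a → ⟪π (t a) ψ, ψ⟫_ℂ = Φ a * ((‖ψ‖ ^ 2 : ℝ) : ℂ)) {a : ℝ} (ha : 0 < a) :
    conj (Φ a) = Φ a :=
  Complex.conj_eq_iff_im.2 (im_eq_zero_of_isUnitary_matrixCoeff hπ t ht hψ Φ hΦ hmc ha)

end Unitary

/-! ## §3 The E1 reading: the right regular representation on `L²(G(F)∖G(𝔸), μ)` of any adelic group datum -/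

section RightRegular

universe u

variable {K : Type} [Field K] [NumberField K] (𝒢 : AdelicGroupData.{u} K)
  (μ : Measure 𝒢.automorphicQuotient) [SMulInvariantMeasure 𝒢.Adelic 𝒢.automorphicQuotient μ]

/-- **ARCH-UNITARITY, GLOBAL HALF, FOR `R` ON `L²(G(F)∖G(𝔸), μ)`** (every ★ adelic group datum `𝒢`, every invariant `μ`; the E1 instance is `𝒢 = quasiSplit L⁺ L c 2`, `t` the split
archimedean torus of `U(1,1)` at one real place, `ψ` a residual vector, `Φ = archTorusCoeff (z₀ + it_v) (p − q)` with ★ `archTorusCoeff_inv`): if `t a⁻¹ = (t a)⁻¹`, `ψ ≠ 0`,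
`Φ(a⁻¹) = Φ(a)` and `⟪R(t a)ψ, ψ⟫ = Φ(a)·‖ψ‖²` for `a > 0` (letter `hmc`), then every `Φ(a)`, `a > 0`, is real.  (★ `isUnitary_rightRegular` ∘ §2.)
[cite: Folland1995, §3.1 and §3.3] [cite: MoeglinWaldspurger1995, IV.3 and V.3.13] -/
theorem im_eq_zero_of_rightRegular_matrixCoeff (t : ℝ → 𝒢.Adelic) (ht : ∀ a : ℝ, 0 < a → t a⁻¹ = (t a)⁻¹)
    {ψ : 𝒢.L2 μ} (hψ : ψ ≠ 0) (Φ : ℝ → ℂ) (hΦ : ∀ a : ℝ, 0 < a → Φ a⁻¹ = Φ a)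
    (hmc : ∀ a : ℝ, 0 < a → ⟪𝒢.rightRegular μ (t a) ψ, ψ⟫_ℂ = Φ a * ((‖ψ‖ ^ 2 : ℝ) : ℂ)) {a : ℝ} (ha : 0 < a) :
    (Φ a).im = 0 :=
  im_eq_zero_of_isUnitary_matrixCoeff (𝒢.isUnitary_rightRegular μ) t ht hψ Φ hΦ hmc ha

end RightRegular

end Summit.HodgeConjecture.HodgeConjecture.Cruxes.H413.K2E1ArchUnitarityOfMatrixCoefficient

end
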